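import Mathlib
import HarnessLib
import Summits.Ventures.LatticeQCDFlow.Scoring.KernelAdmissibleClass
import Summits.Ventures.LatticeQCDFlow.Scoring.AdjointKernelAutocovariance
import Summits.Ventures.LatticeQCDFlow.Scoring.PalindromicSweepReversible
import Summits.Ventures.LatticeQCDFlow.Exactness.AdjointSamplerAutocovariance

/-!
# PALINDROMIC SWEEPS ARE POSITIVE: under `κ† ∘ₖ κ` — and under the forward-then-backward cycle of reversible updates — every bounded observable has nonnegative, nonincreasing autocovariances at every lag

HONEST FRAMING: exact (Metropolis-corrected) sampling algorithms for lattice gauge theory;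
figures of merit are autocorrelation/cost numbers at stated couplings and volumes; no
continuum-physics claim.

Venture `LatticeQCDFlow` (cell pub-lqcd), topic `Scoring`; FANOUT row 8 (`s0-cpn-nemc`, GEN-24).
NEW WORK of the cell: the kernel-level form of `RevOp.palin_autocov_nonneg` / `palin_autocov_succ_le`
(`Exactness/AdjointSamplerAutocovariance`: the palindrome `K K†` of an adjoint pair is a positive
reversible exact sampler) through the bridge `Scoring/KernelAdmissibleClass`, the adjointness on
observables of `Scoring/AdjointKernelAutocovariance` and the cycle bookkeeping of
`Scoring/PalindromicSweepReversible`.  Nothing is cited as a fact.  Printed counterparts NAMED ONLY: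
Liu 1996 (positive operators of independence samplers), Geyer 1992 §3.3, Roberts–Sahu 1997 (the
forward–backward Gibbs sweep).

## Content (`π` a probability law; `(κ, κ')` a `π`-adjoint pair of Markov kernels; `g` bounded
## measurable; `C(t) = autocov (κ' ∘ₖ κ) π g t`)

* **`autocov_adjoint_comp_nonneg`** — `0 ≤ C(t)` for every lag `t`;
  **`autocov_adjoint_comp_succ_le`** — `C(t+1) ≤ C(t)`: monotone decorrelation, never antithetic;
* **`autocov_cycle_append_reverse_nonneg`**, **`autocov_cycle_append_reverse_succ_le`** — the same for
  the palindromic sweep `cycle (Ks ++ Ks.reverse)` of `π`-reversible Markov kernels.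

Reading: observed once per palindromic sweep, every autocorrelation function is a completely tame
(nonnegative, nonincreasing) sequence — windowed `τ` estimates are floors (as for the exact flow
sampler, `Scoring/IndepMHKernelPositive`), whatever the local updates are.  NOT CLAIMED: log-convexity
and the window statements (they follow from `Exactness/ReversiblePositive{,TauInt}` in the same way;
not spelled out); anything for the one-directional sweep; any number of ours.
-/

noncomputable section

namespace Summit.Ventures.LatticeQCDFlow.Scoring

open MeasureTheory ProbabilityTheory Filter Finset Summit.Ventures.LatticeQCDFlow.Exactness
open scoped ENNReal

variable {Ω : Type*} [MeasurableSpace Ω] {π : Measure Ω} [IsProbabilityMeasure π]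

section Pair

variable {κ κ' : Kernel Ω Ω} [IsMarkovKernel κ] [IsMarkovKernel κ']

/-- `kop (κ' ∘ₖ κ) f = kop κ (kop κ' f)` pointwise on the class. -/
theorem kop_adjoint_comp_bddMeas : ∀ ⦃f : Ω → ℝ⦄, (Measurable f ∧ ∃ B, ∀ x, |f x| ≤ B) →
    ∀ x, kop (κ' ∘ₖ κ) f x = kop κ (kop κ' f) x := by
  rintro f ⟨hf, B, hB⟩ x
  rw [kop_comp κ κ' hf hB]

/-- Adjointness on the class, in the `RevOp` shape with weight `1`. -/
theorem kop_adjoint_bddMeas (h : IsAdjointPair κ κ' π) :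
    ∀ ⦃f g : Ω → ℝ⦄, (Measurable f ∧ ∃ B, ∀ x, |f x| ≤ B) → (Measurable g ∧ ∃ B, ∀ x, |g x| ≤ B) →
      ∫ x, kop κ f x * g x * (fun _ : Ω => (1 : ℝ)) x ∂π
        = ∫ x, f x * kop κ' g x * (fun _ : Ω => (1 : ℝ)) x ∂π := by
  rintro f g ⟨hf, Bf, hBf⟩ ⟨hg, Bg, hBg⟩
  simp only [mul_one]
  exact integral_kop_mul_comm_of_isAdjointPair h hf hg hBf hBg

/-- **`κ† ∘ₖ κ` IS A POSITIVE SAMPLER**: `0 ≤ autocov (κ' ∘ₖ κ) π g t` for every bounded measurable `g`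
and every lag `t`. -/
theorem autocov_adjoint_comp_nonneg (h : IsAdjointPair κ κ' π) {g : Ω → ℝ} (hg : Measurable g)
    {B : ℝ} (hB : ∀ x, |g x| ≤ B) (t : ℕ) :
    0 ≤ autocov (κ' ∘ₖ κ) π g t := by
  have key := RevOp.palin_autocov_nonneg (μ := π) (w := fun _ : Ω => (1 : ℝ))
    (A := fun f : Ω → ℝ => Measurable f ∧ ∃ B, ∀ x, |f x| ≤ B) (K := kop κ) (K' := kop κ')
    (P := kop (κ' ∘ₖ κ)) (fun _ => zero_le_one) (kop_bddMeas κ) (kop_bddMeas κ')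
    (kop_adjoint_bddMeas h) kop_adjoint_comp_bddMeas ⟨hg, B, hB⟩ t
  rwa [integral_mul_iterate_kop_mul_one] at key

/-- **Monotone decorrelation under `κ† ∘ₖ κ`**: `autocov (κ' ∘ₖ κ) π g (t+1) ≤ autocov (κ' ∘ₖ κ) π g t`. -/
theorem autocov_adjoint_comp_succ_le (h : IsAdjointPair κ κ' π) {g : Ω → ℝ} (hg : Measurable g)
    {B : ℝ} (hB : ∀ x, |g x| ≤ B) (t : ℕ) :
    autocov (κ' ∘ₖ κ) π g (t + 1) ≤ autocov (κ' ∘ₖ κ) π g t := by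
  have key := RevOp.palin_autocov_succ_le (μ := π) (w := fun _ : Ω => (1 : ℝ))
    (A := fun f : Ω → ℝ => Measurable f ∧ ∃ B, ∀ x, |f x| ≤ B) (K := kop κ) (K' := kop κ')
    (P := kop (κ' ∘ₖ κ)) (fun _ => zero_le_one) bddMeas_integrable_mul bddMeas_add_mul (kop_bddMeas κ)
    (kop_bddMeas κ') (kop_lin_bddMeas κ) (kop_lin_bddMeas κ') (kop_adjoint_bddMeas h)
    (kop_contr_bddMeas κ h.invariant) kop_adjoint_comp_bddMeas ⟨hg, B, hB⟩ t
  rwa [integral_mul_iterate_kop_mul_one, integral_mul_iterate_kop_mul_one] at key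

end Pair

/-! ### The forward-then-backward sweep -/

section Sweep

/-- **THE PALINDROMIC SWEEP IS A POSITIVE SAMPLER**: for every list `Ks` of `π`-reversible Markov
kernels, every bounded measurable `g` and every lag, `0 ≤ autocov (cycle (Ks ++ Ks.reverse)) π g t`. -/
theorem autocov_cycle_append_reverse_nonneg {Ks : List (Kernel Ω Ω)}
    (hM : ∀ κ ∈ Ks, IsMarkovKernel κ) (hrev : ∀ κ ∈ Ks, Kernel.IsReversible κ π) {g : Ω → ℝ}
    (hg : Measurable g) {B : ℝ} (hB : ∀ x, |g x| ≤ B) (t : ℕ) :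
    (haveI := isMarkovKernel_cycle_append_reverse hM
     0 ≤ autocov (cycle (Ks ++ Ks.reverse)) π g t) := by
  haveI := isMarkovKernel_cycle hM
  haveI : IsMarkovKernel (cycle Ks.reverse) :=
    isMarkovKernel_cycle fun η hη => hM η (List.mem_reverse.mp hη)
  have e : cycle (Ks ++ Ks.reverse) = cycle Ks ∘ₖ cycle Ks.reverse := cycle_append _ _
  have key := autocov_adjoint_comp_nonneg (isAdjointPair_cycle_reverse hM hrev).symm hg hB t
  rw [← e] at key
  convert key

/-- **Monotone decorrelation under the palindromic sweep**: `C(t+1) ≤ C(t)` for every bounded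
measurable observable. -/
theorem autocov_cycle_append_reverse_succ_le {Ks : List (Kernel Ω Ω)}
    (hM : ∀ κ ∈ Ks, IsMarkovKernel κ) (hrev : ∀ κ ∈ Ks, Kernel.IsReversible κ π) {g : Ω → ℝ}
    (hg : Measurable g) {B : ℝ} (hB : ∀ x, |g x| ≤ B) (t : ℕ) :
    (haveI := isMarkovKernel_cycle_append_reverse hM
     autocov (cycle (Ks ++ Ks.reverse)) π g (t + 1) ≤ autocov (cycle (Ks ++ Ks.reverse)) π g t) := by
  haveI := isMarkovKernel_cycle hM
  haveI : IsMarkovKernel (cycle Ks.reverse) :=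
    isMarkovKernel_cycle fun η hη => hM η (List.mem_reverse.mp hη)
  have e : cycle (Ks ++ Ks.reverse) = cycle Ks ∘ₖ cycle Ks.reverse := cycle_append _ _
  have key := autocov_adjoint_comp_succ_le (isAdjointPair_cycle_reverse hM hrev).symm hg hB t
  rw [← e] at key
  convert key

end Sweep

end Summit.Ventures.LatticeQCDFlow.Scoring
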